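import Literature.NumberTheory.QuadraticFields.ImaginaryQuadraticPrescribedSplittingInert
import Mathlib.NumberTheory.LegendreSymbol.JacobiSymbol
import HarnessLib

set_option linter.dupNamespace false
set_option autoImplicit false

/-!
# Crux `PrintCf2.SplitBadTwoRankOneOfFacts` (stmt-BirchSwinnertonDyer-20368), road α — FRAME PINNING, IIIa:
# Dirichlet primes INERT in `ℚ(√−m)` and SPLIT in `ℚ(√−7)`

Width seat `bsd-line-cf2-p1-w6` (brick B8 «pinning lemma», 2026-08-28). Arithmetic input of the K-pinning
theorem of `PrintCf2SplitBadTwoFrameFieldPinning.lean` (the frame field of a Hecke character pinned to a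
curve with `j = −3375` is `ℚ(√−7)`). Helper `--supports` stmt-BirchSwinnertonDyer-20368; THEOREMS ONLY.

* `exists_prime_jacobiSym_eq` — for `m ≡ 3 (mod 4)` with `7m` not a perfect square and every bound `n`
  there is a prime `ℓ > n` with `J(−m | ℓ) = −1` and `J(−7 | ℓ) = +1` (inert in `ℚ(√−m)`, split in
  `ℚ(√−7)`). PROOF: write `7m = b²·a` with `a` squarefree (`Nat.sq_mul_squarefree_of_pos`); `a ≠ 1, 7`
  (else `7m` or `m` would be a square; `m ≡ 3 (mod 4)` is not), so some prime `q ≠ 7` divides `a`,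
  `a = q a'`. With `s = (7m)_{q'}` (the prime-to-`q` part; `7 ∣ s`, `a' ∣ s`) take the CRT class
  `r ≡ N (mod q)` (`N` a non-residue), `r ≡ 1 (mod 4s)`: then `r ≡ 1 (mod 28)`, `r` is prime to `28m`,
  `J(−7 | r) = J(−7 | 1) = 1` (`jacobiSym.mod_right`), and by Jacobi reciprocity at `r ≡ 1 (mod 4)`
  `J(7m | r) = J(b | r)²·J(q | r)·J(a' | r) = J(r | q)·J(r | a') = J(N | q)·J(1 | a') = −1`, so
  `J(−m | r) = J(7m | r)/J(−7 | r) = −1`; Dirichlet (Mathlib `Nat.forall_exists_prime_gt_and_zmodEq`) gives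
  primes `ℓ ≡ r (mod 28m)`, and `J(· | ℓ)` only depends on `ℓ mod 4|·|`.

HONEST FRAMING: elementary number theory (Dirichlet's theorem is Mathlib's); nothing about BSD. beyond-print
theorem: no.

References: [IrelandRosen1990] Ch. 16 §1 Thm. 1 (Dirichlet), Ch. 5 §2 (Jacobi symbol and reciprocity);
[Marcus2018] Ch. 3 Thm. 25.
-/

noncomputable section

open scoped Classical NumberTheorySymbols

namespace Summit.BirchSwinnertonDyer.BirchSwinnertonDyer.Theorems.PrintCf2.FramePinning

/-! ## §1 Dirichlet + CRT: primes inert in `ℚ(√−m)` and split in `ℚ(√−7)` -/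

/-- An odd prime `q` has a quadratic non-residue `N ∈ ℕ`: `legendreSym q N = −1`. [folklore] -/
theorem exists_nat_legendreSym_eq_neg_one {q : ℕ} [hq : Fact q.Prime] (hq2 : q ≠ 2) :
    ∃ N : ℕ, legendreSym q N = -1 := by
  have hc : ringChar (ZMod q) ≠ 2 := by rw [ZMod.ringChar_zmod_n]; exact hq2
  obtain ⟨x, hx⟩ := FiniteField.exists_nonsquare hc
  refine ⟨x.val, ?_⟩
  rw [legendreSym.eq_neg_one_iff]
  rwa [Int.cast_natCast, ZMod.natCast_zmod_val]

/-- Along a congruence modulo a multiple of `4|a|`, the Jacobi symbol `J(a | ·)` is constant on odd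
arguments (`jacobiSym.mod_right`). [cite: IrelandRosen1990, Ch. 5 §2 Prop. 5.2.2 (reciprocity for the Jacobi symbol)] -/
theorem jacobiSym_eq_of_mod_eq (a : ℤ) {b b' : ℕ} (hb : Odd b) (hb' : Odd b')
    (h : b % (4 * a.natAbs) = b' % (4 * a.natAbs)) : J(a | b) = J(a | b') := by
  rw [jacobiSym.mod_right a hb, jacobiSym.mod_right a hb', h]

/-- **Primes inert in `ℚ(√−m)` and split in `ℚ(√−7)`, beyond any bound.** For `m ≡ 3 (mod 4)` with `7m`
not a perfect square and every `n` there is a prime `ℓ > n` with `J(−m | ℓ) = −1` and `J(−7 | ℓ) = 1`.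
(Dirichlet's theorem on primes in arithmetic progressions + CRT + Jacobi reciprocity; see the module
docstring for the residue class.) [cite: IrelandRosen1990, Ch. 16 §1 Thm. 1 (Dirichlet) and Ch. 5 §2 (Jacobi symbol)] -/
theorem exists_prime_jacobiSym_eq {m : ℕ} (hm4 : m % 4 = 3) (hns : ¬ IsSquare (7 * m)) (n : ℕ) :
    ∃ ℓ : ℕ, ℓ.Prime ∧ n < ℓ ∧ J(-(m : ℤ) | ℓ) = -1 ∧ J(-7 | ℓ) = 1 := by
  classical
  set A : ℕ := 7 * m with hA
  have hm0 : 0 < m := by omega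
  have hA0 : 0 < A := by omega
  have hA2 : ¬ 2 ∣ A := by omega
  -- squarefree decomposition `A = b² a`
  obtain ⟨a, b, ha0, hb0, hab, hsq⟩ := Nat.sq_mul_squarefree_of_pos hA0
  -- a prime `q ∣ a`, `q ≠ 7`
  obtain ⟨q, hq, hqa, hq7⟩ : ∃ q : ℕ, q.Prime ∧ q ∣ a ∧ q ≠ 7 := by
    have ha1 : a ≠ 1 := by
      rintro rfl
      exact hns ⟨b, by rw [← hab]; ring⟩
    by_cases h7 : 7 ∣ a
    · obtain ⟨a', rfl⟩ := h7
      have ha'1 : a' ≠ 1 := by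
        rintro rfl
        -- `7m = 7 b²`, so `m = b²`, impossible mod `4`
        have hmb : m = b ^ 2 := by
          have h1 : b ^ 2 * (7 * 1) = 7 * m := by rw [hab]
          linarith
        have hb4 : b % 4 < 4 := Nat.mod_lt _ (by norm_num)
        have hsqmod : b ^ 2 % 4 = (b % 4) ^ 2 % 4 := Nat.pow_mod b 2 4
        interval_cases hb : b % 4 <;> omega
      obtain ⟨q, hq, hqa'⟩ := Nat.exists_prime_and_dvd ha'1
      refine ⟨q, hq, Dvd.dvd.mul_left hqa' 7, fun h ↦ ?_⟩
      subst h
      have h49 : 7 * 7 ∣ 7 * a' := Nat.mul_dvd_mul_left 7 hqa'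
      have hu := hsq 7 h49
      rw [Nat.isUnit_iff] at hu
      norm_num at hu
    · obtain ⟨q, hq, hqa⟩ := Nat.exists_prime_and_dvd ha1
      exact ⟨q, hq, hqa, fun h ↦ h7 (h ▸ hqa)⟩
  haveI : Fact q.Prime := ⟨hq⟩
  have haA : a ∣ A := ⟨b ^ 2, by rw [← hab]; ring⟩
  have hqA : q ∣ A := hqa.trans haA
  have hq2 : q ≠ 2 := fun h ↦ hA2 (h ▸ hqA)
  have hqodd : Odd q := hq.odd_of_ne_two hq2
  -- `a = q a'`, `a'` prime to `q`
  obtain ⟨a', rfl⟩ := hqa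
  have hqa' : ¬ q ∣ a' := fun h ↦ by
    have hu := hsq q (Nat.mul_dvd_mul_left q h)
    rw [Nat.isUnit_iff] at hu
    exact hq.one_lt.ne' hu
  -- `s := (A)_{q'}`, the prime-to-`q` part: `A = q^v s`, `q ∤ s`, `7 ∣ s`, `a' ∣ s`
  set v : ℕ := A.factorization q with hv
  set s : ℕ := A / q ^ v with hs
  have hAqs : q ^ v * s = A := Nat.ordProj_mul_ordCompl_eq_self A q
  have hqs : Nat.Coprime q s := Nat.coprime_ordCompl hq hA0.ne'
  have hs0 : s ≠ 0 := fun h ↦ by rw [h, mul_zero] at hAqs; omega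
  have h7s : 7 ∣ s := by
    have h7q : Nat.Coprime 7 (q ^ v) :=
      Nat.Coprime.pow_right v ((Nat.coprime_primes (by decide) hq).mpr (Ne.symm hq7))
    exact h7q.dvd_of_dvd_mul_left (by rw [hAqs]; exact Dvd.intro m rfl)
  have ha's : a' ∣ s := by
    have h1 : Nat.Coprime a' (q ^ v) :=
      Nat.Coprime.pow_right v ((Nat.Prime.coprime_iff_not_dvd hq).mpr hqa').symm
    exact h1.dvd_of_dvd_mul_left (by rw [hAqs]; exact (Dvd.intro_left q rfl).trans haA)
  have hsA : s ∣ A := ⟨q ^ v, by rw [mul_comm, hAqs]⟩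
  have hs2 : ¬ 2 ∣ s := fun h ↦ hA2 (h.trans hsA)
  have ha'2 : ¬ 2 ∣ a' := fun h ↦ hs2 (h.trans ha's)
  -- a non-residue mod `q`, and the CRT class `r`
  obtain ⟨N, hN⟩ := exists_nat_legendreSym_eq_neg_one hq2
  have hcop : Nat.Coprime q (4 * s) := by
    refine Nat.Coprime.mul_right ?_ hqs
    have h2 : Nat.Coprime q 2 := (Nat.coprime_primes hq Nat.prime_two).mpr hq2
    simpa using h2.pow_right 2
  obtain ⟨r, hrq, hrs⟩ := Nat.chineseRemainder hcop N 1
  have hr4 : r % 4 = 1 := by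
    have h := Nat.ModEq.of_mul_right s hrs
    exact h
  have hrodd : Odd r := Nat.odd_iff.mpr (by omega)
  have hr28 : r % 28 = 1 := by
    have h28 : 28 ∣ 4 * s := by
      obtain ⟨k, hk⟩ := h7s
      exact ⟨k, by rw [hk]; ring⟩
    have h := Nat.ModEq.of_dvd h28 hrs
    exact h
  have hrs' : r ≡ 1 [MOD s] := Nat.ModEq.of_dvd (Dvd.intro_left 4 rfl) hrs
  have hra' : r ≡ 1 [MOD a'] := Nat.ModEq.of_dvd ((ha's).trans (Dvd.intro_left 4 rfl)) hrs
  -- `r` is prime to `4A`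
  have hqr : ¬ q ∣ r := by
    intro h
    have h0 : (r : ZMod q) = 0 := (ZMod.natCast_eq_zero_iff r q).mpr h
    have hNq : (N : ZMod q) = 0 := by
      rw [← h0]; exact ((ZMod.natCast_eq_natCast_iff _ _ _).mpr hrq).symm
    have : legendreSym q N = 0 := by
      rw [legendreSym.eq_zero_iff]; exact_mod_cast hNq
    rw [this] at hN
    norm_num at hN
  have hcopr : Nat.Coprime r (4 * A) := by
    have hr2 : Nat.Coprime r 2 :=
      ((Nat.Prime.coprime_iff_not_dvd Nat.prime_two).mpr (by omega)).symm
    have hr4' : Nat.Coprime r 4 := by simpa using hr2.pow_right 2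
    refine Nat.Coprime.mul_right hr4' ?_
    rw [← hAqs]
    refine Nat.Coprime.mul_right (Nat.Coprime.pow_right v ?_) ?_
    · exact ((Nat.Prime.coprime_iff_not_dvd hq).mpr hqr).symm
    · have h := hrs'.gcd_eq
      rwa [Nat.gcd_one_left] at h
  -- Dirichlet
  have h4A0 : 4 * A ≠ 0 := by omega
  obtain ⟨ℓ, hℓn, hℓ, hℓmod⟩ := Nat.forall_exists_prime_gt_and_zmodEq (max n 2) (q := 4 * A)
    (a := (r : ℤ)) h4A0 (Nat.isCoprime_iff_coprime.mpr hcopr)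
  simp only [max_lt_iff] at hℓn
  have hℓodd : Odd ℓ := hℓ.odd_of_ne_two (by omega)
  have hmodN : ℓ ≡ r [MOD 4 * A] := Int.natCast_modEq_iff.mp hℓmod
  -- transport of the two symbols from `r` to `ℓ`
  have hJm : J(-(m : ℤ) | ℓ) = J(-(m : ℤ) | r) := by
    refine jacobiSym_eq_of_mod_eq _ hℓodd hrodd ?_
    have h4m : 4 * (-(m : ℤ)).natAbs ∣ 4 * A := by
      simp only [Int.natAbs_neg, Int.natAbs_natCast]
      exact ⟨7, by rw [hA]; ring⟩
    exact Nat.ModEq.of_dvd h4m hmodN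
  have hJ7 : J(-7 | ℓ) = J(-7 | r) := by
    refine jacobiSym_eq_of_mod_eq _ hℓodd hrodd ?_
    have h28 : 4 * (-7 : ℤ).natAbs ∣ 4 * A := ⟨m, by rw [hA]; norm_num; ring⟩
    exact Nat.ModEq.of_dvd h28 hmodN
  -- `J(−7 | r) = 1`
  have hJ7r : J(-7 | r) = 1 := by
    rw [jacobiSym.mod_right (-7) hrodd, show 4 * (-7 : ℤ).natAbs = 28 by norm_num, hr28,
      jacobiSym.one_right]
  -- `J(7m | r) = −1`
  have hgcd_br : (b : ℤ).gcd r = 1 := by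
    rw [Int.gcd_natCast_natCast]
    have hbA : b ∣ A := ⟨b * (q * a'), by rw [← hab]; ring⟩
    exact Nat.Coprime.coprime_dvd_left hbA (hcopr.symm.coprime_dvd_left (Dvd.intro_left 4 rfl))
  have hJq : J((q : ℤ) | r) = -1 := by
    rw [jacobiSym.quadratic_reciprocity_one_mod_four' hqodd hr4]
    have hmod : (r : ℤ) % q = (N : ℤ) % q := by exact_mod_cast hrq
    rw [jacobiSym.mod_left' hmod, ← jacobiSym.legendreSym.to_jacobiSym, hN]
  have hJa' : J((a' : ℤ) | r) = 1 := by
    have ha'odd : Odd a' := Nat.odd_iff.mpr (by omega)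
    rw [jacobiSym.quadratic_reciprocity_one_mod_four' ha'odd hr4]
    have hmod : (r : ℤ) % a' = (1 : ℤ) % a' := by exact_mod_cast hra'
    rw [jacobiSym.mod_left' hmod, jacobiSym.one_left]
  have hJA : J((A : ℤ) | r) = -1 := by
    have hAZ : (A : ℤ) = (b : ℤ) ^ 2 * ((q : ℤ) * (a' : ℤ)) := by
      rw [← hab]; push_cast; ring
    rw [hAZ, jacobiSym.mul_left, jacobiSym.mul_left, jacobiSym.sq_one' hgcd_br, hJq, hJa']
    norm_num
  -- hence `J(−m | r) = −1`
  have hJmr : J(-(m : ℤ) | r) = -1 := by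
    have hprod : J((A : ℤ) | r) = J(-7 | r) * J(-(m : ℤ) | r) := by
      rw [← jacobiSym.mul_left]; congr 1; rw [hA]; push_cast; ring
    rw [hJA, hJ7r, one_mul] at hprod
    exact hprod.symm
  exact ⟨ℓ, hℓ, hℓn.1, hJm.trans hJmr, hJ7.trans hJ7r⟩

end Summit.BirchSwinnertonDyer.BirchSwinnertonDyer.Theorems.PrintCf2.FramePinning

end
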